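import Summits.FinalStateConjecture.FinalStateConjecture.Theorems.HonestFixedRadiusSettling.Negative.CoreLoadBearing
import Summits.FinalStateConjecture.FinalStateConjecture.Theorems.HonestFixedRadiusSettling.Negative.MaximalityLoadBearing

/-!
# Crux `StarvedNecks.HonestFixedRadiusSettling` (stmt-FinalStateConjecture-13550) — negative side,
# generation 3, part II: the maximality guard of the live leaf `stub_core` is load-bearing

Part I (`CoreLoadBearing.lean`) read the leaf back as `coreSet` and showed that a development with
incomplete `𝓘⁺` carries no one atlas at infinity. Instantiated at the landed time-truncated Minkowski
development of the trivial data (`TruncatedMinkowski.development`, incomplete `𝓘⁺` by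
`not_hasCompleteNullInfinity_development`):

* `TruncatedMinkowski.not_mem_oneAtlasDecompositions_truncated` — NO `Cᵏ` (`k ≥ 1`) final-state
  decomposition of any region of `{x⁰ < T}` satisfies the seventeen one-atlas clauses (paper reading:
  EXACT + ZONE + ATTACHED alone fail there — the vertical chart lines over a fixed far point would be
  timelike curves from `Σ` of unbounded proper time inside a slab of height `T`);
* `trivialData_exceptional_coreWithoutIsMaximal` — with the guard `𝒟.IsMaximal →` deleted from the
  leaf's property `Q`, the admissible trivial datum is EXCEPTIONAL, although every clause of `Q` holds
  at the Minkowski development itself (crux-plan sanity lemma `oneAtlasAtInfinity_minkowski`; Disproof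
  §8d): ANY PROOF OF `stub_core` MUST USE MAXIMALITY, at least to exclude time truncations;
* `not_coreWithoutIsMaximal_of_not_core`, `not_coreWithoutIsMaximal_of_not_crux` — the unguarded
  leaf is stronger than the leaf and than the crux; `curve_obligation_of_coreWithoutIsMaximal` — it
  would demand at the trivial datum an admissible curve all of whose other members carry one atlas
  at infinity on EVERY vacuum Cauchy development (absurd on paper; not refutable in a tree that
  constructs no development of a non-trivial datum).

`sorry`-free, no named facts, no definitions. References: Choquet-Bruhat–Geroch, CMP 14 (1969)
(maximal developments); Christodoulou, CQG 16 (1999) A23, p. A24.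
-/

noncomputable section

set_option linter.dupNamespace false

open Literature.Geometry.Lorentzian
open scoped Manifold ContDiff ENNReal Topology
open Filter Set TopologicalSpace

namespace Summit.FinalStateConjecture.FinalStateConjecture.Theorems.HonestFixedRadiusSettling.Negative

open Summit.FinalStateConjecture.FinalStateConjecture.Theses.StarvedNecks (HonestFixedRadiusSettling)

namespace TruncatedMinkowski

/-- **No one atlas at infinity on a time truncation**: on `{x⁰ < T}` no `Cᵏ` (`k ≥ 1`) final-state
decomposition of any region admits the seventeen clauses (part I at the truncated development). -/
theorem not_mem_oneAtlasDecompositions_truncated {T : ℝ} (hT : 0 < T)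
    (O : Set (development T hT).carrier) {k : ℕ} (hk : 1 ≤ k)
    (d : FinalStateDecomposition (development T hT).toSpacetime O k) :
    d ∉ oneAtlasDecompositions (development T hT) O k :=
  not_mem_oneAtlasDecompositions_of_not_hasCompleteNullInfinity (not_hasCompleteNullInfinity_development hT) O hk d

/-- Hence the truncated development is not an honest one-atlas development of the trivial data. -/
theorem development_not_mem_oneAtlasHonestDevelopments {T : ℝ} (hT : 0 < T) :
    development T hT ∉ oneAtlasHonestDevelopments trivialData :=
  not_mem_oneAtlasHonestDevelopments_of_not_hasCompleteNullInfinity (not_hasCompleteNullInfinity_development hT)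

end TruncatedMinkowski

/-- **Without the guard `𝒟.IsMaximal →` the TRIVIAL DATA are exceptional for the leaf's `Q`.** -/
theorem trivialData_exceptional_coreWithoutIsMaximal :
    trivialData ∈ admissibleVacuumData Minkowski.slice ∧
      trivialData ∉ coreSetWithoutIsMaximal Minkowski.slice :=
  ⟨trivialData_mem_admissibleVacuumData, fun h ↦
    TruncatedMinkowski.development_not_mem_oneAtlasHonestDevelopments one_pos (h.2 _)⟩

/-- The unguarded generic statement is STRONGER than `stub_core` (genericity is monotone in the
property); negatively: a refutation of `stub_core` refutes it. -/
theorem not_coreWithoutIsMaximal_of_not_core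
    (hn : ¬ ∀ (X : Type) [TopologicalSpace X] [ChartedSpace E3 X] [IsManifold (𝓡 3) ∞ X] [T2Space X]
      [SecondCountableTopology X] [ConnectedSpace X],
      InitialDataSet.IsChristodoulouGeneric (admissibleVacuumData X) (· ∈ coreSet X) 1) :
    ¬ ∀ (X : Type) [TopologicalSpace X] [ChartedSpace E3 X] [IsManifold (𝓡 3) ∞ X] [T2Space X]
      [SecondCountableTopology X] [ConnectedSpace X],
      InitialDataSet.IsChristodoulouGeneric (admissibleVacuumData X) (· ∈ coreSetWithoutIsMaximal X) 1 := by
  intro h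
  apply hn
  intro X _ _ _ _ _ _
  exact isChristodoulouGeneric_mono (fun _ _ hD ↦ coreSetWithoutIsMaximal_subset_coreSet hD) (h X)

/-- A refutation of the crux refutes the unguarded leaf as well. -/
theorem not_coreWithoutIsMaximal_of_not_crux (hn : ¬ HonestFixedRadiusSettling) :
    ¬ ∀ (X : Type) [TopologicalSpace X] [ChartedSpace E3 X] [IsManifold (𝓡 3) ∞ X] [T2Space X]
      [SecondCountableTopology X] [ConnectedSpace X],
      InitialDataSet.IsChristodoulouGeneric (admissibleVacuumData X) (· ∈ coreSetWithoutIsMaximal X) 1 :=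
  not_coreWithoutIsMaximal_of_not_core (not_coreGeneric_of_not_crux hn)

/-- The explicit obligation the unguarded leaf would create at the simplest datum: a smooth injective
admissible curve through the trivial data ALL of whose other members carry, on EVERY vacuum Cauchy
development (maximal or not), an honest `C⁴` decomposition with one atlas at infinity. -/
theorem curve_obligation_of_coreWithoutIsMaximal
    (h : ∀ (X : Type) [TopologicalSpace X] [ChartedSpace E3 X] [IsManifold (𝓡 3) ∞ X] [T2Space X]
      [SecondCountableTopology X] [ConnectedSpace X],
      InitialDataSet.IsChristodoulouGeneric (admissibleVacuumData X) (· ∈ coreSetWithoutIsMaximal X) 1) :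
    ∃ F : EuclideanSpace ℝ (Fin 1) → InitialDataSet (𝓡 3) Minkowski.slice,
      InitialDataSet.IsSmoothDataFamily 1 F ∧ F 0 = trivialData ∧ Function.Injective F ∧
        (∀ c, F c ∈ admissibleVacuumData Minkowski.slice) ∧
        ∀ c, c ≠ 0 → ∀ 𝒟 : VacuumCauchyDevelopment (F c), 𝒟 ∈ oneAtlasHonestDevelopments (F c) := by
  obtain ⟨F, hF, h0, hinj, hmem, hE⟩ := h Minkowski.slice trivialData
    ⟨trivialData_mem_admissibleVacuumData, trivialData_exceptional_coreWithoutIsMaximal.2⟩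
  refine ⟨F, hF, h0, hinj, hmem, fun c hc 𝒟 ↦ ?_⟩
  by_contra hcon
  exact hE c hc ⟨hmem c, fun hP ↦ hcon (hP.2 𝒟)⟩

end Summit.FinalStateConjecture.FinalStateConjecture.Theorems.HonestFixedRadiusSettling.Negative

end
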